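import Summits.AnomalousDissipation.AnomalousDissipation.Theses.PointSink
import Summits.AnomalousDissipation.AnomalousDissipation.Theorems.PointSinkConeDesingularisationStubEnvelopeOfFarField
import Summits.AnomalousDissipation.AnomalousDissipation.Theorems.PointSinkConeDesingularisationStubDissipationPosOfFarField
import Literature.Analysis.FluidPDE.SteadyNSLiouville
import Literature.Analysis.FluidPDE.SteadyDSolutionAsymptotics
import Literature.Analysis.FluidPDE.SteadyLiouvilleNineHalvesProofs
import Summits.AnomalousDissipation.AnomalousDissipation.Theorems.ConeDesingularisation.Negative.FedConeFloor

/-!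
# Disproof of `ConeDesingularisation` — findings (cdisprove cycle 1, refuter-cdisprove-stmt-AnomalousDissipation-19034-0;
# cycle 3 = §5 FLUX TRANSFER, refuter ad-pointsink-ref-1, 2026-08-27 — read §5 and `## HANDOFF` at the end first)

Crux stmt-AnomalousDissipation-19034, route `PointSink`, decl
`Summit.AnomalousDissipation.AnomalousDissipation.Theses.PointSink.ConeDesingularisation`.

VERDICT OF THIS CYCLE: **no kill; the crux resists for a structural reason** (§0): it is LITERALLY
`PointFluxCone → CascadeSoliton` (`crux_iff`, `Iff.rfl`), so `¬ crux ↔ PointFluxCone ∧ ¬ CascadeSoliton`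
(`not_crux_iff`): a refutation needs BOTH a point-flux cone (the rank-2 crux of the same route, an XL open
construction — the 0-dimensional stationary Onsager problem; its line `Sketch` is a Choffrut–Székelyhidi
convex-integration programme, stubs landing under `Theorems/PointSinkPointFluxCone*`) AND a Liouville theorem
for smooth steady NS in the critical `L²`-mass class (Galdi's Liouville problem, open; every printed criterion is
borderline-missed, see the route header and grounder notes). Neither half is available, and no junk/degenerate
instance exists: the audit of every definition in the signature (`IsClassicalNSSolutionOn` = smooth + pointwise
NS, no decay built in; `IsTestFunctionOn` = smooth, compact support, `tsupport ⊆ Ω`; `divergence` = trace of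
`fderiv`; Bochner integrals in the cone are genuine because `‖V‖² ∈ L¹_loc`, `P ∈ L¹_loc` off `0` make the weak
Euler integrand integrable for every test supported off `0`) found nothing to exploit.

WHAT IS PROVED HERE (all sorry-free; the certified copies are proposed under
`Theorems/ConeDesingularisation/Negative/{FarFieldMass,LiouvilleReduction,SketchStubs,LpEscape}.lean`, p161581 /
p163677 / p163680 (ACCEPTED, commit cbfad0deb66e) / p164125):

* §0 SHAPE: `crux_iff`, `not_crux_iff`, `cone_and_not_cascadeSoliton_of_not_crux` (the two degenerate ways the
  crux could hold — the node proved outright, or the cone refuted, the latter killing the route by (k1) —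
  stated negatively).
* §1 TIGHTNESS of the far-field clause (`shell_mass_floor`): for ANY continuous `Q` shell-asymptotic to a
  non-trivial (−2/3)-DSS `V`, eventually `(λ^k)^{5/3} c₀/4 ≤ ∫_{λ^k<‖x‖<λ^{k+1}}‖Q‖²` — the floor matching the
  landed stub-4 ceiling: the soliton's mass growth `∫_{B_R}‖Q‖² ≍ R^{5/3}` is pinned from both sides.
* §2 REFUTED NATURAL STRENGTHENINGS of the conclusion: `cascadeSoliton_infinite_energy` (no finite-energy
  soliton: `Q ∉ L²(ℝ³)`), `not_cascadeSoliton_with_envelope_lt` (no envelope exponent `s < 5/3`), and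
  `coneDesingularisation_with_envelope_lt_iff` (with `s < 5/3` the crux is EQUIVALENT to `¬ PointFluxCone`).
  §2c `not_memLp_of_shell_mass_floor` (Hölder on the shells + tails of a convergent integral): a continuous
  field with the shell-mass floor is in NO `L^p(ℝ³)`, `2 ≤ p ≤ 9/2` — so Galdi X.9.5 (`L^{9/2}`, tree
  `galdi_liouville_nineHalves`) and every criterion through `Q ∈ L^p`, `p ≤ 9/2`, CANNOT bite the conclusion
  (proposed as `Negative/LpEscape.lean`, p164125). Paper remarks: `R^{-1}∫_{λ-shell k}‖Q‖³ ≥ c > 0`, but the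
  crux's `L²` matching does not bound the `L³` mass of EVERY dyadic annulus, so Seregin–Wang's / Tsai's
  `liminf_{R→∞} R^{-1/3}‖Q‖_{L³(B_R∖B_{R/2})} = 0 ⇒ Q ≡ 0` (tree `sereginWang_liouville_L3_annulus`) is missed
  too; it does say that a soliton's far field must charge every dyadic annulus in `L³` (profile constraint for
  cone hunters: no DSS cone supported on thin shells can feed a soliton with `L³` matching).
* §3 KILL CRITERION (k2) FORMAL: `limit_eq_zero_of_envelope` (the `R^{5/3}` envelope pins any limit at
  infinity to `0`), `isDSolution_of_cascade` (the soliton is a tree `IsDSolution 1 0`),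
  `not_cascadeSoliton_of_liouville` : `SteadyDSolutionLiouvilleProblem → wang2025_rem21_DSolution_tendsto_const →
  ¬ CascadeSoliton`, hence `coneDesingularisation_iff_not_cone_of_liouville`: UNDER THE LIOUVILLE CONJECTURE
  (plus Galdi X.5.1 / Wang Rem. 2.1, a vendored fact) THE CRUX IS `¬ PointFluxCone`. So every proof of the crux
  either refutes its own route's cone or refutes Liouville for steady `D`-solutions; every refutation of the crux
  proves Liouville-at-this-object AND builds the cone.
* §4 TARGETS (line `Sketch`, skeleton registered 2026-08-17T11:40Z; stubs 1, 2, 4, 5 already LANDED by provers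
  under `Theorems/PointSinkConeDesingularisationStub*`): load-bearing lemmas
  `stub_dissipationPosOfFarField_false_without_nontrivial`, `…_false_without_matching`,
  `stub_envelopeOfFarField_false_without_matching`, with the MODEL CONE `‖x‖^{-2/3} e₀` (`model_*`) as a reusable
  non-trivial inhabitant of the far-field data. `stub_core` (the lead's, = the crux in ∀-over-cones form,
  conclusion tied to THE given cone) is refutable only by exhibiting a cone — same shield as the crux; its
  conclusion at `V = 0` is trivially inhabited by `Q = 0` (all difficulty enters through `flux < 0 ⇒ V ≢ 0`,
  stub 2).

WHY IT RESISTS / NEAR-MISSES (paper, for ideators):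
* Explicit cone candidates all fail PointFluxCone: potential cones (`V = ∇φ`, `φ` (1/3)-homogeneous harmonic)
  and Beltrami cones have head `H ≡ 0` by homogeneity ⇒ fluxless; the shear cone `(0,0,w(x₁,x₂))`,
  `w ~ r^{-2/3}`, IS a weak Euler solution off the axis with `P = 0` but its flux density `w³x₃/|x|²` is NOT
  integrable on the shell (log-divergence at the axis: exactly the `L³` borderline) and is `x₃`-odd anyway.
* The homogeneous flux identity `(3α−2)∫_{S²} f h = 0` DEGENERATES at `α = 2/3`: fluxlessness of `C¹` profiles
  (Shvydkoy 2018 L6.1) is not a scaling accident but a transport/recurrence fact (bounded head ⇒ streamlines with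
  `H ≠ 0` cannot reach `0` or `∞`; volume flux balance), consistent with the ideators' D1 truncation–scaling
  rigidity: any cone feeding the crux has a NON-renormalised head (below `C^{1/2}`, not `BV`).
* Consequently the conclusion's `Q` must be shell-`L²`-close to a WILD field while being smooth with
  `Σ_k ∫_{shell k}|∇Q|² < ∞`; in blow-down variables `Q_k(y) = λ^{2k/3}Q(λ^k y)` this is a steady
  vanishing-viscosity sequence (`ν_k = λ^{-k/3}`) converging to `V` in `L²(shell 0)` with
  `ν_k ∫_{shell 0}|∇Q_k|² = ∫_{shell k}|∇Q|² → 0`: NO local anomalous dissipation off the origin. No contradiction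
  follows (L² convergence does not control the cubic flux), but it is the sharpest necessary condition found:
  a cone that is the far field of a soliton is a zero-viscosity limit of steady NS with vanishing local
  dissipation away from the tip.
* Informal gap in the birth line (invading spheres, superseded by `Sketch`): a cone with `d^{-2/3}` singular rays
  has trace on spheres outside `H^{1/2}(S²)` (`2/3 + 1/2 > 1`), so it is not admissible Leray–Dirichlet data with
  finite Dirichlet integral — mollify or match on annuli instead.

Next attacks (cycle 2 if granted): the stub set of whatever line the lead drives next (`stub_core` reshapes); a `_false_without_` analysis of `stub_core`'s local-integrability
hypotheses is junk-only (documented, not worth landing); watch the `PointFluxCone` CI line — if it lands, §3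
upgrades to `SteadyDSolutionLiouvilleProblem → ¬ ConeDesingularisation` (negative-modulo-Liouville).
-/

noncomputable section

-- `Summit.<Summit>.<Problem>`: single-conjunct summit, the duplicate namespace is mandated (CONVENTIONS §2).
set_option linter.dupNamespace false

open MeasureTheory Filter Topology Set
open scoped Pointwise ENNReal
open Literature.Analysis.FunctionSpaces Literature.Analysis.FluidPDE

namespace Summit.AnomalousDissipation.AnomalousDissipation.Cruxes.ConeDesingularisation.Disproof

open Summit.AnomalousDissipation.AnomalousDissipation.Theses.PointSink
  (PointFluxCone ConeDesingularisation CascadeSoliton)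
open Summit.AnomalousDissipation.AnomalousDissipation.Theorems
  (coneEnvelope_setIntegral_shell_normSq coneEnvelope_integrableOn_shell coneEnvelope_smul_shell
    coneDissip_volumeReal_shell_pos coneDissip_volume_shell_lt_top coneDissip_isOpen_shell
    coneDissip_integrableOn_shell)

/-! ## §0 The shape of the crux and of a kill -/

/-- **The crux unfolded**: `ConeDesingularisation` is literally the implication from the rank-2 crux to
the support node `CascadeSoliton` of the same route. [folklore] -/
theorem crux_iff : ConeDesingularisation ↔ (PointFluxCone → CascadeSoliton) := Iff.rfl

/-- **Shape of a kill**: refuting the crux means producing a point-flux cone AND proving that no cascade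
soliton exists (a Liouville theorem in the critical `L²`-mass class). Both conjuncts are open problems;
this is why the crux resists cheap refutation. [folklore] -/
theorem not_crux_iff : ¬ ConeDesingularisation ↔ (PointFluxCone ∧ ¬ CascadeSoliton) := by
  rw [crux_iff, Classical.not_imp]

/-- The two DEGENERATE ways the crux could hold, recorded as one equivalence-free remark: it follows
from its conclusion alone (support item stmt-AnomalousDissipation-19036 proved outright) and it follows
VACUOUSLY from the failure of its hypothesis (the rank-2 crux refuted — which kills the route by (k1)).
Stated negatively: if the crux fails then the cone exists and the node fails. [folklore] -/
theorem cone_and_not_cascadeSoliton_of_not_crux (h : ¬ ConeDesingularisation) :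
    PointFluxCone ∧ ¬ CascadeSoliton :=
  not_crux_iff.1 h

/-! ## §3 Kill criterion (k2), formal: under Liouville the conclusion is empty -/

/-- **The `R^{5/3}` envelope pins the limit at infinity to `0`.** If a continuous field with the
`L²`-mass envelope `∫_{B_R} ‖Q‖² ≤ C R^{5/3}` (`R ≥ 1`) converges to a constant vector `u₀` at infinity
(`cocompact`), then `u₀ = 0`: otherwise `‖Q‖ ≥ ‖u₀‖/2` outside a ball `B_{R₀}` and
`∫_{B_R}‖Q‖² ≥ (‖u₀‖/2)² (R³|B_1| − |B̄_{R₀}|) ≫ C R^{5/3}`. This is the step that lets a user holding only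
the envelope (not `Q ∈ L⁶`) feed a pointwise-decay Liouville theorem. [folklore] -/
theorem limit_eq_zero_of_envelope {Q : EuclideanSpace ℝ (Fin 3) → EuclideanSpace ℝ (Fin 3)} (hQ : Continuous Q) {C : ℝ}
    (hC : ∀ R : ℝ, 1 ≤ R → ∫ x in Metric.ball (0 : EuclideanSpace ℝ (Fin 3)) R, ‖Q x‖ ^ 2 ≤ C * R ^ (5 / 3 : ℝ))
    {u₀ : EuclideanSpace ℝ (Fin 3)} (hlim : Tendsto Q (cocompact (EuclideanSpace ℝ (Fin 3))) (𝓝 u₀)) : u₀ = 0 := by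
  by_contra hu
  set a : ℝ := ‖u₀‖ with ha
  have ha0 : 0 < a := norm_pos_iff.2 hu
  -- far out, `‖Q x‖ ≥ a/2`
  have hev : ∀ᶠ x in cocompact (EuclideanSpace ℝ (Fin 3)), dist (Q x) u₀ < a / 2 :=
    Metric.tendsto_nhds.1 hlim (a / 2) (by linarith)
  obtain ⟨t, ht, hts⟩ := mem_cocompact.1 hev
  obtain ⟨R₀, hR₀⟩ := (ht.isBounded).subset_closedBall (0 : EuclideanSpace ℝ (Fin 3))
  have hfar : ∀ x : EuclideanSpace ℝ (Fin 3), R₀ < ‖x‖ → a / 2 ≤ ‖Q x‖ := by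
    intro x hx
    have hxt : x ∉ t := by
      intro hxt
      have := hR₀ hxt
      rw [Metric.mem_closedBall, dist_zero_right] at this
      linarith
    have h1 : dist (Q x) u₀ < a / 2 := hts hxt
    rw [dist_eq_norm] at h1
    have h2 : ‖u₀‖ - ‖Q x‖ ≤ ‖Q x - u₀‖ := by
      have := norm_sub_norm_le u₀ (Q x)
      rwa [norm_sub_rev] at this
    linarith
  -- volumes
  set v₁ : ℝ := volume.real (Metric.ball (0 : EuclideanSpace ℝ (Fin 3)) 1) with hv₁
  have hv₁pos : 0 < v₁ :=
    ENNReal.toReal_pos (Metric.measure_ball_pos volume (0 : EuclideanSpace ℝ (Fin 3)) one_pos).ne'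
      (measure_ball_lt_top).ne
  have hballvol : ∀ R : ℝ, 0 < R →
      volume.real (Metric.ball (0 : EuclideanSpace ℝ (Fin 3)) R) = R ^ 3 * v₁ := by
    intro R hR
    simp only [hv₁, measureReal_def]
    rw [Measure.addHaar_ball_of_pos volume (0 : EuclideanSpace ℝ (Fin 3)) hR, ENNReal.toReal_mul,
      ENNReal.toReal_ofReal (pow_nonneg hR.le _), finrank_euclideanSpace_fin]
  set K : ℝ := volume.real (Metric.closedBall (0 : EuclideanSpace ℝ (Fin 3)) R₀) with hK
  have hK0 : 0 ≤ K := measureReal_nonneg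
  -- lower bound on balls: (R³ v₁ - K) (a/2)² ≤ C R^{5/3} for R ≥ max 1 R₀
  have key : ∀ R : ℝ, 1 ≤ R → R₀ ≤ R → (R ^ 3 * v₁ - K) * (a / 2) ^ 2 ≤ C * R ^ (5 / 3 : ℝ) := by
    intro R hR1 hR0
    have hRpos : 0 < R := by linarith
    set D : Set (EuclideanSpace ℝ (Fin 3)) := Metric.ball (0 : EuclideanSpace ℝ (Fin 3)) R \ Metric.closedBall (0 : EuclideanSpace ℝ (Fin 3)) R₀ with hD
    have hDm : MeasurableSet D := measurableSet_ball.diff measurableSet_closedBall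
    have hDsub : D ⊆ Metric.ball (0 : EuclideanSpace ℝ (Fin 3)) R := Set.sdiff_subset
    have hDfin : volume D ≠ ⊤ := measure_ne_top_of_subset hDsub measure_ball_lt_top.ne
    have iQ : IntegrableOn (fun x => ‖Q x‖ ^ 2) (Metric.ball (0 : EuclideanSpace ℝ (Fin 3)) R) volume :=
      (((hQ.norm.pow 2).continuousOn).integrableOn_compact (isCompact_closedBall (0 : EuclideanSpace ℝ (Fin 3)) R)).mono_set
        Metric.ball_subset_closedBall
    have h1 : ∫ x in D, ‖Q x‖ ^ 2 ≤ ∫ x in Metric.ball (0 : EuclideanSpace ℝ (Fin 3)) R, ‖Q x‖ ^ 2 :=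
      setIntegral_mono_set iQ (ae_of_all _ fun x => sq_nonneg _) (ae_of_all _ hDsub)
    have h2 : ∫ x in D, (a / 2) ^ 2 ≤ ∫ x in D, ‖Q x‖ ^ 2 := by
      refine setIntegral_mono_on (integrableOn_const hDfin) (iQ.mono_set hDsub) hDm fun x hx => ?_
      have hxR₀ : R₀ < ‖x‖ := by
        have := hx.2
        rw [Metric.mem_closedBall, dist_zero_right, not_le] at this
        exact this
      exact pow_le_pow_left₀ (by linarith) (hfar x hxR₀) 2
    have h3 : ∫ x in D, (a / 2) ^ 2 = volume.real D * (a / 2) ^ 2 := by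
      rw [setIntegral_const, smul_eq_mul]
    have h4 : R ^ 3 * v₁ - K ≤ volume.real D := by
      have := le_measureReal_sdiff (μ := volume) (s₁ := Metric.ball (0 : EuclideanSpace ℝ (Fin 3)) R)
        (s₂ := Metric.closedBall (0 : EuclideanSpace ℝ (Fin 3)) R₀) measure_closedBall_lt_top.ne
      rwa [hballvol R hRpos] at this
    have h5 : (R ^ 3 * v₁ - K) * (a / 2) ^ 2 ≤ volume.real D * (a / 2) ^ 2 :=
      mul_le_mul_of_nonneg_right h4 (sq_nonneg _)
    linarith [hC R hR1]
  -- growth contradiction: R^{5/3} ≤ R², so R v₁ (a/2)² ≤ |C| + K (a/2)² for all large R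
  have key2 : ∀ R : ℝ, 1 ≤ R → R₀ ≤ R → R * (v₁ * (a / 2) ^ 2) ≤ |C| + K * (a / 2) ^ 2 := by
    intro R hR1 hR0
    have hRpos : 0 < R := by linarith
    have h53 : R ^ (5 / 3 : ℝ) ≤ R ^ (2 : ℝ) := Real.rpow_le_rpow_of_exponent_le hR1 (by norm_num)
    rw [Real.rpow_two] at h53
    have h1 := key R hR1 hR0
    have h2a : C * R ^ (5 / 3 : ℝ) ≤ |C| * R ^ (5 / 3 : ℝ) :=
      mul_le_mul_of_nonneg_right (le_abs_self C) (Real.rpow_nonneg hRpos.le _)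
    have h2b : |C| * R ^ (5 / 3 : ℝ) ≤ |C| * R ^ 2 := mul_le_mul_of_nonneg_left h53 (abs_nonneg C)
    have h3 : (R ^ 3 * v₁ - K) * (a / 2) ^ 2 ≤ |C| * R ^ 2 := h1.trans (h2a.trans h2b)
    have hR2 : (1 : ℝ) ≤ R ^ 2 := one_le_pow₀ hR1
    have hR2pos : (0 : ℝ) < R ^ 2 := by positivity
    have ha2 : 0 ≤ (a / 2) ^ 2 := sq_nonneg _
    have h4 : R * (v₁ * (a / 2) ^ 2) * R ^ 2 ≤ (|C| + K * (a / 2) ^ 2) * R ^ 2 := by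
      nlinarith [mul_nonneg hK0 ha2, abs_nonneg C]
    exact le_of_mul_le_mul_right h4 hR2pos
  set M : ℝ := |C| + K * (a / 2) ^ 2 with hM
  set w : ℝ := v₁ * (a / 2) ^ 2 with hw
  have hwpos : 0 < w := mul_pos hv₁pos (by positivity)
  set R : ℝ := max (max 1 R₀) (M / w + 1) with hR
  have hR1 : 1 ≤ R := (le_max_left _ _).trans (le_max_left _ _)
  have hR0 : R₀ ≤ R := (le_max_right _ _).trans (le_max_left _ _)
  have hRM : M / w + 1 ≤ R := le_max_right _ _
  have h1 := key2 R hR1 hR0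
  have h2 : (M / w + 1) * w ≤ R * w := mul_le_mul_of_nonneg_right hRM hwpos.le
  rw [add_mul, div_mul_cancel₀ _ hwpos.ne', one_mul] at h2
  linarith

/-- **The soliton is a `D`-solution** in the tree's sense: a steady classical unforced unit-viscosity
solution on the time set `univ` with `∫ |∇Q|² < ∞` is `IsDSolution 1 0 Q P` (momentum rearranged via the
Leray-profile bridge; `Integrable ⇒ ∫⁻ ofReal < ∞`). [folklore] -/
theorem isDSolution_of_cascade {Q : EuclideanSpace ℝ (Fin 3) → EuclideanSpace ℝ (Fin 3)} {P : EuclideanSpace ℝ (Fin 3) → ℝ}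
    (h : IsClassicalNSSolutionOn (univ : Set ℝ) 1 (fun _ _ => 0) (fun _ => Q) (fun _ => P))
    (hInt : Integrable (fun x => frobeniusNormSq (fderiv ℝ Q x))) : IsDSolution 1 0 Q P := by
  have hprof := h.isLerayProfile_zero_of_steady
  refine ⟨?_, hInt.lintegral_lt_top⟩
  exact
    { contDiff_velocity := hprof.contDiff_velocity
      contDiff_pressure := hprof.contDiff_pressure
      momentum := fun y => by
        have := hprof.profile_eq y
        simp only [zero_smul, add_zero] at this
        simpa using this
      divFree := hprof.divFree }

/-- **Kill criterion (k2), formal: under Liouville there is no cascade soliton.** Assume the OPEN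
Liouville conjecture for steady `D`-solutions on `ℝ³` (`SteadyDSolutionLiouvilleProblem`: smooth, finite
Dirichlet integral, `u → 0` pointwise ⇒ `u ≡ 0`) and Galdi's Thm X.5.1 in the form of Wang 2025,
Remark 2.1 (`wang2025_rem21_DSolution_tendsto_const`: every `D`-solution tends to SOME constant at
infinity). Then the conclusion of the crux is empty: the soliton is a `D`-solution, tends to a constant,
the `R^{5/3}` envelope forces that constant to be `0`, Liouville gives `Q ≡ 0`, contradicting
`0 < ∫ |∇Q|²`. [folklore] -/
theorem not_cascadeSoliton_of_liouville (hL : SteadyDSolutionLiouvilleProblem)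
    (hrem : wang2025_rem21_DSolution_tendsto_const) : ¬ CascadeSoliton := by
  rintro ⟨Q, P, hNS, ⟨C, hC⟩, hInt, hpos, -⟩
  have hprof : IsLerayProfile 1 0 Q P := hNS.isLerayProfile_zero_of_steady
  have hD : IsDSolution 1 0 Q P := isDSolution_of_cascade hNS hInt
  obtain ⟨u₀, hu₀⟩ := hrem Q P hD
  have hQs : ContDiff ℝ (⊤ : ℕ∞) Q := hNS.contDiff_velocity (mem_univ (0 : ℝ))
  have hPs : ContDiff ℝ (⊤ : ℕ∞) P := hNS.contDiff_pressure (mem_univ (0 : ℝ))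
  have hu0 : u₀ = 0 := limit_eq_zero_of_envelope hQs.continuous hC hu₀
  subst hu0
  have hQ0 : Q = 0 := hL Q P hprof hQs hPs hD.2 hu₀
  subst hQ0
  simp [frobeniusNormSq_zero] at hpos

/-- **Under Liouville the crux is `¬ PointFluxCone`.** With the two hypotheses of
`not_cascadeSoliton_of_liouville`, `ConeDesingularisation` holds iff its own rank-2 sibling `PointFluxCone`
fails. Information for allocation: every proof of the crux either refutes the cone (and the route dies by
(k1)) or refutes the Liouville conjecture for steady `D`-solutions. [folklore] -/
theorem coneDesingularisation_iff_not_cone_of_liouville (hL : SteadyDSolutionLiouvilleProblem)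
    (hrem : wang2025_rem21_DSolution_tendsto_const) : ConeDesingularisation ↔ ¬ PointFluxCone :=
  ⟨fun h hc => not_cascadeSoliton_of_liouville hL hrem (h hc), fun h hc => absurd hc h⟩


/-! ## §1 The shell-mass floor (tightness of the far-field clause) -/

/-- **Shell-mass floor (tightness of the far-field clause).** If a continuous `Q` is shell-`L²`
asymptotic at rate `o((λ^k)^{5/3})` to a measurable `V`, DSS of degree `-2/3` with `‖V‖²` locally
integrable off the origin, then eventually `(λ^k)^{5/3} · c₀/4 ≤ ∫_{λ^k<‖x‖<λ^{k+1}} ‖Q‖²`,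
`c₀ = ∫_{1<‖x‖<λ} ‖V‖²`: the soliton carries at least a quarter of the cone's mass on every far shell
(pointwise `‖V‖² ≤ 2‖Q‖² + 2‖Q−V‖²`, the DSS scaling `∫_{shell k}‖V‖² = (λ^k)^{5/3} c₀`, and the shell
error eventually below `(λ^k)^{5/3} c₀/4`). [folklore] -/
theorem shell_mass_floor {lam : ℝ} {V Q : EuclideanSpace ℝ (Fin 3) → EuclideanSpace ℝ (Fin 3)}
    (hlam : 1 < lam) (hQ : Continuous Q) (hV : AEStronglyMeasurable V volume)
    (hVss : ∀ x : EuclideanSpace ℝ (Fin 3), x ≠ 0 → V (lam • x) = lam ^ (-(2 / 3 : ℝ)) • V x)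
    (hVloc : LocallyIntegrableOn (fun x => ‖V x‖ ^ 2) {x : EuclideanSpace ℝ (Fin 3) | x ≠ 0} volume)
    (hTend : Tendsto (fun k : ℕ => (lam ^ k) ^ (-(5 / 3 : ℝ)) *
        ∫ x in {x : EuclideanSpace ℝ (Fin 3) | lam ^ k < ‖x‖ ∧ ‖x‖ < lam ^ (k + 1)}, ‖Q x - V x‖ ^ 2)
        atTop (𝓝 0)) :
    ∀ᶠ k : ℕ in atTop,
      (lam ^ k) ^ (5 / 3 : ℝ) * ((∫ x in {x : EuclideanSpace ℝ (Fin 3) | 1 < ‖x‖ ∧ ‖x‖ < lam}, ‖V x‖ ^ 2) / 4) ≤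
        ∫ x in {x : EuclideanSpace ℝ (Fin 3) | lam ^ k < ‖x‖ ∧ ‖x‖ < lam ^ (k + 1)}, ‖Q x‖ ^ 2 := by
  set c₀ : ℝ := ∫ x in {x : EuclideanSpace ℝ (Fin 3) | 1 < ‖x‖ ∧ ‖x‖ < lam}, ‖V x‖ ^ 2 with hc₀
  have hlam0 : 0 < lam := by linarith
  -- shells are measurable; continuous fields are integrable on them
  have hmeas : ∀ a b : ℝ, MeasurableSet {x : EuclideanSpace ℝ (Fin 3) | a < ‖x‖ ∧ ‖x‖ < b} := fun a b =>
    ((isOpen_lt continuous_const continuous_norm).inter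
      (isOpen_lt continuous_norm continuous_const)).measurableSet
  have hcont : ∀ {g : EuclideanSpace ℝ (Fin 3) → ℝ}, Continuous g → ∀ a b : ℝ,
      IntegrableOn g {x : EuclideanSpace ℝ (Fin 3) | a < ‖x‖ ∧ ‖x‖ < b} volume := fun hg a b =>
    (hg.continuousOn.integrableOn_compact (isCompact_closedBall (0 : EuclideanSpace ℝ (Fin 3)) b)).mono_set
      fun x hx => by
        rw [Metric.mem_closedBall, dist_zero_right]
        exact hx.2.le
  rcases le_or_gt c₀ 0 with hc | hc
  · refine Eventually.of_forall fun k => ?_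
    have h1 : 0 ≤ ∫ x in {x : EuclideanSpace ℝ (Fin 3) | lam ^ k < ‖x‖ ∧ ‖x‖ < lam ^ (k + 1)}, ‖Q x‖ ^ 2 :=
      setIntegral_nonneg (hmeas _ _) fun x _ => sq_nonneg _
    have h2 : (lam ^ k) ^ (5 / 3 : ℝ) * (c₀ / 4) ≤ 0 :=
      mul_nonpos_of_nonneg_of_nonpos (Real.rpow_nonneg (pow_nonneg hlam0.le k) _) (by linarith)
    linarith
  · have hev : ∀ᶠ k : ℕ in atTop, (lam ^ k) ^ (-(5 / 3 : ℝ)) *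
        ∫ x in {x : EuclideanSpace ℝ (Fin 3) | lam ^ k < ‖x‖ ∧ ‖x‖ < lam ^ (k + 1)}, ‖Q x - V x‖ ^ 2 <
          c₀ / 4 :=
      hTend.eventually (gt_mem_nhds (by linarith))
    filter_upwards [hev] with k hk
    have hLk : 0 < lam ^ k := pow_pos hlam0 k
    have hL : 0 < (lam ^ k) ^ (5 / 3 : ℝ) := Real.rpow_pos_of_pos hLk _
    -- the error bound
    have hB : ∫ x in {x : EuclideanSpace ℝ (Fin 3) | lam ^ k < ‖x‖ ∧ ‖x‖ < lam ^ (k + 1)}, ‖Q x - V x‖ ^ 2 <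
        (c₀ / 4) * (lam ^ k) ^ (5 / 3 : ℝ) := by
      rw [Real.rpow_neg hLk.le] at hk
      rwa [inv_mul_lt_iff₀ hL, mul_comm] at hk
    -- the exact mass of `V` on the shell (landed DSS change of variables)
    have hVk : ∫ x in {x : EuclideanSpace ℝ (Fin 3) | lam ^ k < ‖x‖ ∧ ‖x‖ < lam ^ (k + 1)}, ‖V x‖ ^ 2 =
        (lam ^ k) ^ (5 / 3 : ℝ) * c₀ :=
      coneEnvelope_setIntegral_shell_normSq hlam0 hVss k
    -- integrability on the shell
    have iQ : IntegrableOn (fun x => ‖Q x‖ ^ 2)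
        {x : EuclideanSpace ℝ (Fin 3) | lam ^ k < ‖x‖ ∧ ‖x‖ < lam ^ (k + 1)} volume := hcont (hQ.norm.pow 2) _ _
    have iV : IntegrableOn (fun x => ‖V x‖ ^ 2)
        {x : EuclideanSpace ℝ (Fin 3) | lam ^ k < ‖x‖ ∧ ‖x‖ < lam ^ (k + 1)} volume :=
      coneEnvelope_integrableOn_shell hVloc _ hLk
    have i2 : IntegrableOn (fun x => 2 * ‖Q x‖ ^ 2 + 2 * ‖V x‖ ^ 2)
        {x : EuclideanSpace ℝ (Fin 3) | lam ^ k < ‖x‖ ∧ ‖x‖ < lam ^ (k + 1)} volume :=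
      (iQ.const_mul 2).add (iV.const_mul 2)
    have iD : IntegrableOn (fun x => ‖Q x - V x‖ ^ 2)
        {x : EuclideanSpace ℝ (Fin 3) | lam ^ k < ‖x‖ ∧ ‖x‖ < lam ^ (k + 1)} volume := by
      refine Integrable.mono' i2 ((hQ.aestronglyMeasurable.sub hV).norm.pow 2).restrict
        (ae_of_all _ fun x => ?_)
      rw [Real.norm_eq_abs, abs_of_nonneg (sq_nonneg _)]
      have h := norm_sub_le (Q x) (V x)
      nlinarith [norm_nonneg (Q x - V x), norm_nonneg (Q x), norm_nonneg (V x),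
        sq_nonneg (‖Q x‖ - ‖V x‖)]
    have hmono : ∫ x in {x : EuclideanSpace ℝ (Fin 3) | lam ^ k < ‖x‖ ∧ ‖x‖ < lam ^ (k + 1)}, ‖V x‖ ^ 2 ≤
        ∫ x in {x : EuclideanSpace ℝ (Fin 3) | lam ^ k < ‖x‖ ∧ ‖x‖ < lam ^ (k + 1)},
          (2 * ‖Q x‖ ^ 2 + 2 * ‖Q x - V x‖ ^ 2) := by
      refine integral_mono iV ((iQ.const_mul 2).add (iD.const_mul 2)) fun x => ?_
      have h := norm_sub_le (Q x) (Q x - V x)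
      rw [sub_sub_cancel] at h
      dsimp only
      nlinarith [norm_nonneg (V x), norm_nonneg (Q x), norm_nonneg (Q x - V x),
        sq_nonneg (‖Q x‖ - ‖Q x - V x‖)]
    rw [integral_add (iQ.const_mul 2) (iD.const_mul 2), integral_const_mul, integral_const_mul,
      hVk] at hmono
    nlinarith

/-- The floor `(λ^k)^{5/3} c` tends to `+∞` (`λ > 1`, `c > 0`). [folklore] -/
theorem tendsto_rpow_pow_five_thirds_mul_atTop {lam c : ℝ} (hlam : 1 < lam) (hc : 0 < c) :
    Tendsto (fun k : ℕ => (lam ^ k) ^ (5 / 3 : ℝ) * c) atTop atTop := by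
  have h0 : (0 : ℝ) ≤ lam := by linarith
  have h1 : 1 < lam ^ (5 / 3 : ℝ) := Real.one_lt_rpow hlam (by norm_num)
  have h3 : (fun k : ℕ => (lam ^ k) ^ (5 / 3 : ℝ) * c) = fun k => (lam ^ (5 / 3 : ℝ)) ^ k * c := by
    funext k
    congr 1
    rw [← Real.rpow_natCast_mul h0, mul_comm (k : ℝ), Real.rpow_mul_natCast h0]
  rw [h3]
  exact (tendsto_pow_atTop_atTop_of_one_lt h1).atTop_mul_const hc

/-! ## §2a Refuted strengthening: finite energy -/

/-- **A cascade soliton has infinite energy** (refuted strengthening `Q ∈ L²(ℝ³)` of the conclusion):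
the far-field clause with a far field that is non-trivial on the fundamental shell forbids
`∫_{ℝ³} ‖Q‖² < ∞` — the shell masses `∫_{shell k}‖Q‖² ≥ (λ^k)^{5/3} c₀/4` are unbounded, while each is
at most `∫ ‖Q‖²`. [folklore] -/
theorem not_integrable_normSq_of_farField {lam : ℝ}
    {V Q : EuclideanSpace ℝ (Fin 3) → EuclideanSpace ℝ (Fin 3)} (hlam : 1 < lam)
    (hQ : Continuous Q) (hV : AEStronglyMeasurable V volume)
    (hVss : ∀ x : EuclideanSpace ℝ (Fin 3), x ≠ 0 → V (lam • x) = lam ^ (-(2 / 3 : ℝ)) • V x)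
    (hVloc : LocallyIntegrableOn (fun x => ‖V x‖ ^ 2) {x : EuclideanSpace ℝ (Fin 3) | x ≠ 0} volume)
    (hpos : 0 < ∫ x in {x : EuclideanSpace ℝ (Fin 3) | 1 < ‖x‖ ∧ ‖x‖ < lam}, ‖V x‖ ^ 2)
    (hTend : Tendsto (fun k : ℕ => (lam ^ k) ^ (-(5 / 3 : ℝ)) *
        ∫ x in {x : EuclideanSpace ℝ (Fin 3) | lam ^ k < ‖x‖ ∧ ‖x‖ < lam ^ (k + 1)}, ‖Q x - V x‖ ^ 2)
        atTop (𝓝 0)) :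
    ¬ Integrable (fun x => ‖Q x‖ ^ 2) volume := by
  intro hint
  have hle : ∀ k : ℕ,
      ∫ x in {x : EuclideanSpace ℝ (Fin 3) | lam ^ k < ‖x‖ ∧ ‖x‖ < lam ^ (k + 1)}, ‖Q x‖ ^ 2 ≤
        ∫ x, ‖Q x‖ ^ 2 := fun k =>
    setIntegral_le_integral hint (ae_of_all _ fun x => sq_nonneg _)
  have hfloor := shell_mass_floor hlam hQ hV hVss hVloc hTend
  have hbig := (tendsto_rpow_pow_five_thirds_mul_atTop hlam
    (show 0 < (∫ x in {x : EuclideanSpace ℝ (Fin 3) | 1 < ‖x‖ ∧ ‖x‖ < lam}, ‖V x‖ ^ 2) / 4 by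
      linarith)).eventually_gt_atTop (∫ x, ‖Q x‖ ^ 2)
  obtain ⟨k, hk1, hk2⟩ := (hfloor.and hbig).exists
  linarith [hle k]

/-- **No finite-energy cascade soliton**: the conclusion of `ConeDesingularisation` (= the body of
`CascadeSoliton`) is incompatible with `∫_{ℝ³}‖Q‖² < ∞`; only the smoothness of `Q` and the far-field
block are used. [folklore] -/
theorem cascadeSoliton_infinite_energy
    (Q : EuclideanSpace ℝ (Fin 3) → EuclideanSpace ℝ (Fin 3)) (P : EuclideanSpace ℝ (Fin 3) → ℝ)
    (hNS : IsClassicalNSSolutionOn Set.univ 1 (fun _ _ => 0) (fun _ => Q) (fun _ => P))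
    (hfar : ∃ (lam : ℝ) (V : EuclideanSpace ℝ (Fin 3) → EuclideanSpace ℝ (Fin 3)),
      1 < lam ∧ AEStronglyMeasurable V volume ∧
      (∀ x : EuclideanSpace ℝ (Fin 3), x ≠ 0 → V (lam • x) = lam ^ (-(2 / 3 : ℝ)) • V x) ∧
      LocallyIntegrableOn (fun x => ‖V x‖ ^ 2) {x : EuclideanSpace ℝ (Fin 3) | x ≠ 0} volume ∧
      0 < ∫ x in {x : EuclideanSpace ℝ (Fin 3) | 1 < ‖x‖ ∧ ‖x‖ < lam}, ‖V x‖ ^ 2 ∧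
      Tendsto (fun k : ℕ => (lam ^ k) ^ (-(5 / 3 : ℝ)) *
        ∫ x in {x : EuclideanSpace ℝ (Fin 3) | lam ^ k < ‖x‖ ∧ ‖x‖ < lam ^ (k + 1)}, ‖Q x - V x‖ ^ 2)
        atTop (𝓝 0)) :
    ¬ Integrable (fun x => ‖Q x‖ ^ 2) volume := by
  obtain ⟨lam, V, hlam, hV, hVss, hVloc, hpos, hTend⟩ := hfar
  exact not_integrable_normSq_of_farField hlam (hNS.contDiff_velocity (mem_univ (0 : ℝ))).continuous
    hV hVss hVloc hpos hTend

/-! ## §2b Refuted strengthening: a sub-critical envelope -/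

/-- **The envelope exponent `5/3` is sharp** (refuted strengthening of the conclusion): under the
far-field clause with a non-trivial far field, NO envelope `∫_{B_R}‖Q‖² ≤ C R^s` (`R ≥ 1`) with `s < 5/3`
holds — the shell `λ^k < ‖x‖ < λ^{k+1}` lies in `B_{λ^{k+1}}` and already carries mass
`≥ (λ^k)^{5/3} c₀/4 ≫ C λ^{(k+1)s}`. [folklore] -/
theorem not_envelope_of_lt {lam : ℝ} {V Q : EuclideanSpace ℝ (Fin 3) → EuclideanSpace ℝ (Fin 3)}
    (hlam : 1 < lam) (hQ : Continuous Q) (hV : AEStronglyMeasurable V volume)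
    (hVss : ∀ x : EuclideanSpace ℝ (Fin 3), x ≠ 0 → V (lam • x) = lam ^ (-(2 / 3 : ℝ)) • V x)
    (hVloc : LocallyIntegrableOn (fun x => ‖V x‖ ^ 2) {x : EuclideanSpace ℝ (Fin 3) | x ≠ 0} volume)
    (hpos : 0 < ∫ x in {x : EuclideanSpace ℝ (Fin 3) | 1 < ‖x‖ ∧ ‖x‖ < lam}, ‖V x‖ ^ 2)
    (hTend : Tendsto (fun k : ℕ => (lam ^ k) ^ (-(5 / 3 : ℝ)) *
        ∫ x in {x : EuclideanSpace ℝ (Fin 3) | lam ^ k < ‖x‖ ∧ ‖x‖ < lam ^ (k + 1)}, ‖Q x - V x‖ ^ 2)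
        atTop (𝓝 0))
    {s : ℝ} (hs : s < 5 / 3) :
    ¬ ∃ C : ℝ, ∀ R : ℝ, 1 ≤ R →
      ∫ x in Metric.ball (0 : EuclideanSpace ℝ (Fin 3)) R, ‖Q x‖ ^ 2 ≤ C * R ^ s := by
  rintro ⟨C, hC⟩
  have hlam0 : 0 < lam := by linarith
  set c₀ : ℝ := ∫ x in {x : EuclideanSpace ℝ (Fin 3) | 1 < ‖x‖ ∧ ‖x‖ < lam}, ‖V x‖ ^ 2 with hc₀
  have hfloor := shell_mass_floor hlam hQ hV hVss hVloc hTend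
  -- upper bound on the shells from the envelope
  have hup : ∀ k : ℕ,
      ∫ x in {x : EuclideanSpace ℝ (Fin 3) | lam ^ k < ‖x‖ ∧ ‖x‖ < lam ^ (k + 1)}, ‖Q x‖ ^ 2 ≤
        C * lam ^ s * (lam ^ (s - 5 / 3)) ^ k * (lam ^ k) ^ (5 / 3 : ℝ) := by
    intro k
    have hLk : 0 < lam ^ k := pow_pos hlam0 k
    have hsub : {x : EuclideanSpace ℝ (Fin 3) | lam ^ k < ‖x‖ ∧ ‖x‖ < lam ^ (k + 1)} ⊆
        Metric.ball (0 : EuclideanSpace ℝ (Fin 3)) (lam ^ (k + 1)) :=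
      fun x hx => by rw [Metric.mem_ball, dist_zero_right]; exact hx.2
    have iQ : IntegrableOn (fun x => ‖Q x‖ ^ 2) (Metric.ball (0 : EuclideanSpace ℝ (Fin 3)) (lam ^ (k + 1)))
        volume :=
      ((hQ.norm.pow 2).continuousOn.integrableOn_compact
        (isCompact_closedBall (0 : EuclideanSpace ℝ (Fin 3)) (lam ^ (k + 1)))).mono_set
        Metric.ball_subset_closedBall
    have h1 : ∫ x in {x : EuclideanSpace ℝ (Fin 3) | lam ^ k < ‖x‖ ∧ ‖x‖ < lam ^ (k + 1)}, ‖Q x‖ ^ 2 ≤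
        ∫ x in Metric.ball (0 : EuclideanSpace ℝ (Fin 3)) (lam ^ (k + 1)), ‖Q x‖ ^ 2 :=
      setIntegral_mono_set iQ (ae_of_all _ fun x => sq_nonneg _) (ae_of_all _ hsub)
    have h2 := hC (lam ^ (k + 1)) (one_le_pow₀ hlam.le)
    have h3 : C * (lam ^ (k + 1)) ^ s =
        C * lam ^ s * (lam ^ (s - 5 / 3)) ^ k * (lam ^ k) ^ (5 / 3 : ℝ) := by
      have hcomm : (lam ^ (s - 5 / 3)) ^ k = (lam ^ k) ^ (s - 5 / 3) := by
        rw [← Real.rpow_mul_natCast hlam0.le, mul_comm, Real.rpow_natCast_mul hlam0.le]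
      rw [pow_succ', Real.mul_rpow hlam0.le hLk.le, hcomm, Real.rpow_sub hLk,
        mul_assoc, mul_assoc, div_mul_cancel₀ _ (Real.rpow_pos_of_pos hLk _).ne']
    linarith
  -- combine with the floor: `c₀/4 ≤ C λ^s q^k` eventually, `q = λ^{s-5/3} < 1`
  have hkey : ∀ᶠ k : ℕ in atTop, c₀ / 4 ≤ C * lam ^ s * (lam ^ (s - 5 / 3)) ^ k := by
    filter_upwards [hfloor] with k hk
    have hL : 0 < (lam ^ k) ^ (5 / 3 : ℝ) := Real.rpow_pos_of_pos (pow_pos hlam0 k) _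
    have := hk.trans (hup k)
    rw [mul_comm] at this
    exact le_of_mul_le_mul_right this hL
  have hq0 : 0 ≤ lam ^ (s - 5 / 3) := Real.rpow_nonneg hlam0.le _
  have hq1 : lam ^ (s - 5 / 3) < 1 := Real.rpow_lt_one_of_one_lt_of_neg hlam (by linarith)
  have hlim : Tendsto (fun k : ℕ => C * lam ^ s * (lam ^ (s - 5 / 3)) ^ k) atTop (𝓝 0) := by
    simpa using (tendsto_pow_atTop_nhds_zero_of_lt_one hq0 hq1).const_mul (C * lam ^ s)
  have hsmall : ∀ᶠ k : ℕ in atTop, C * lam ^ s * (lam ^ (s - 5 / 3)) ^ k < c₀ / 4 :=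
    (tendsto_order.1 hlim).2 _ (by linarith)
  obtain ⟨k, hk1, hk2⟩ := (hkey.and hsmall).exists
  linarith

/-- **The conclusion with a sub-critical envelope is false**: replacing the exponent `5/3` of the
`L²`-mass envelope by any `s < 5/3` (all other clauses of the conclusion of `ConeDesingularisation`
verbatim) gives an unsatisfiable statement. (`s = 5/3` is verbatim `CascadeSoliton`, believed false but
OPEN — Galdi's Liouville problem in the critical `L²`-mass class.) [folklore] -/
theorem not_cascadeSoliton_with_envelope_lt {s : ℝ} (hs : s < 5 / 3) :
    ¬ ∃ (Q : EuclideanSpace ℝ (Fin 3) → EuclideanSpace ℝ (Fin 3)) (P : EuclideanSpace ℝ (Fin 3) → ℝ),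
      IsClassicalNSSolutionOn Set.univ 1 (fun _ _ => 0) (fun _ => Q) (fun _ => P) ∧
      (∃ C : ℝ, ∀ R : ℝ, 1 ≤ R →
        ∫ x in Metric.ball (0 : EuclideanSpace ℝ (Fin 3)) R, ‖Q x‖ ^ 2 ≤ C * R ^ s) ∧
      Integrable (fun x => frobeniusNormSq (fderiv ℝ Q x)) ∧
      0 < ∫ x, frobeniusNormSq (fderiv ℝ Q x) ∧
      ∃ (lam : ℝ) (V : EuclideanSpace ℝ (Fin 3) → EuclideanSpace ℝ (Fin 3)),
        1 < lam ∧ AEStronglyMeasurable V volume ∧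
        (∀ x : EuclideanSpace ℝ (Fin 3), x ≠ 0 → V (lam • x) = lam ^ (-(2 / 3 : ℝ)) • V x) ∧
        LocallyIntegrableOn (fun x => ‖V x‖ ^ 2) {x : EuclideanSpace ℝ (Fin 3) | x ≠ 0} volume ∧
        0 < ∫ x in {x : EuclideanSpace ℝ (Fin 3) | 1 < ‖x‖ ∧ ‖x‖ < lam}, ‖V x‖ ^ 2 ∧
        Tendsto (fun k : ℕ => (lam ^ k) ^ (-(5 / 3 : ℝ)) *
          ∫ x in {x : EuclideanSpace ℝ (Fin 3) | lam ^ k < ‖x‖ ∧ ‖x‖ < lam ^ (k + 1)}, ‖Q x - V x‖ ^ 2)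
          atTop (𝓝 0) := by
  rintro ⟨Q, P, hNS, hC, -, -, lam, V, hlam, hV, hVss, hVloc, hpos, hTend⟩
  exact not_envelope_of_lt hlam (hNS.contDiff_velocity (mem_univ (0 : ℝ))).continuous hV hVss hVloc
    hpos hTend hs hC

/-- **With a sub-critical envelope the crux collapses to `¬ PointFluxCone`**: the strengthening
`PointFluxCone → (CascadeSoliton with envelope exponent s < 5/3)` of `ConeDesingularisation` holds iff
the rank-2 crux `PointFluxCone` of the same route FAILS — i.e. only where the route is dead by its own
kill criterion (k1). Information for the planner: the exponent `5/3` in the crux is the only value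
compatible with the far-field clause. [folklore] -/
theorem coneDesingularisation_with_envelope_lt_iff {s : ℝ} (hs : s < 5 / 3) :
    (PointFluxCone →
      ∃ (Q : EuclideanSpace ℝ (Fin 3) → EuclideanSpace ℝ (Fin 3)) (P : EuclideanSpace ℝ (Fin 3) → ℝ),
      IsClassicalNSSolutionOn Set.univ 1 (fun _ _ => 0) (fun _ => Q) (fun _ => P) ∧
      (∃ C : ℝ, ∀ R : ℝ, 1 ≤ R →
        ∫ x in Metric.ball (0 : EuclideanSpace ℝ (Fin 3)) R, ‖Q x‖ ^ 2 ≤ C * R ^ s) ∧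
      Integrable (fun x => frobeniusNormSq (fderiv ℝ Q x)) ∧
      0 < ∫ x, frobeniusNormSq (fderiv ℝ Q x) ∧
      ∃ (lam : ℝ) (V : EuclideanSpace ℝ (Fin 3) → EuclideanSpace ℝ (Fin 3)),
        1 < lam ∧ AEStronglyMeasurable V volume ∧
        (∀ x : EuclideanSpace ℝ (Fin 3), x ≠ 0 → V (lam • x) = lam ^ (-(2 / 3 : ℝ)) • V x) ∧
        LocallyIntegrableOn (fun x => ‖V x‖ ^ 2) {x : EuclideanSpace ℝ (Fin 3) | x ≠ 0} volume ∧
        0 < ∫ x in {x : EuclideanSpace ℝ (Fin 3) | 1 < ‖x‖ ∧ ‖x‖ < lam}, ‖V x‖ ^ 2 ∧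
        Tendsto (fun k : ℕ => (lam ^ k) ^ (-(5 / 3 : ℝ)) *
          ∫ x in {x : EuclideanSpace ℝ (Fin 3) | lam ^ k < ‖x‖ ∧ ‖x‖ < lam ^ (k + 1)}, ‖Q x - V x‖ ^ 2)
          atTop (𝓝 0)) ↔
    ¬ PointFluxCone :=
  ⟨fun h hc => not_cascadeSoliton_with_envelope_lt hs (h hc), fun h hc => absurd hc h⟩


/-! ## §2c Refuted strengthening: `Q ∈ L^p(ℝ³)` for some `2 ≤ p ≤ 9/2` (the `L^p` escape) -/

/-- Volume of the `k`-th DSS shell: `|{λ^k < ‖x‖ < λ^{k+1}}| = (λ^k)³ |{1 < ‖x‖ < λ}|`. [folklore] -/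
theorem volume_real_shell_pow {lam : ℝ} (hlam : 0 < lam) (k : ℕ) :
    volume.real {x : EuclideanSpace ℝ (Fin 3) | lam ^ k < ‖x‖ ∧ ‖x‖ < lam ^ (k + 1)} =
      (lam ^ k) ^ 3 * volume.real {x : EuclideanSpace ℝ (Fin 3) | 1 < ‖x‖ ∧ ‖x‖ < lam} := by
  have hLk : 0 < lam ^ k := pow_pos hlam k
  have hset : {x : EuclideanSpace ℝ (Fin 3) | lam ^ k < ‖x‖ ∧ ‖x‖ < lam ^ (k + 1)} =
      (lam ^ k) • {x : EuclideanSpace ℝ (Fin 3) | 1 < ‖x‖ ∧ ‖x‖ < lam} := by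
    rw [coneEnvelope_smul_shell lam hLk, ← pow_succ]
  rw [hset, measureReal_def, measureReal_def, Measure.addHaar_smul, finrank_euclideanSpace_fin,
    ENNReal.toReal_mul, ENNReal.toReal_ofReal (abs_nonneg _), abs_of_pos (pow_pos hLk 3)]

/-- **The `L^p` escape.** A continuous field with the Galdi-critical shell-mass floor
`(λ^k)^{5/3} c ≤ ∫_{λ^k<‖x‖<λ^{k+1}} ‖Q‖²` (eventually in `k`; `λ > 1`, `c > 0`) belongs to NO `L^p(ℝ³)`
with `2 ≤ p ≤ 9/2`. In particular (with `Negative/FarFieldMass.shell_mass_floor`) a cascade soliton is in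
no such `L^p`, and Galdi's `L^{9/2}` Liouville theorem cannot bite the conclusion of the crux. [folklore] -/
theorem not_memLp_of_shell_mass_floor {lam : ℝ}
    {Q : EuclideanSpace ℝ (Fin 3) → EuclideanSpace ℝ (Fin 3)} (hlam : 1 < lam) (hQ : Continuous Q)
    {c : ℝ} (hc : 0 < c)
    (hfloor : ∀ᶠ k : ℕ in atTop, (lam ^ k) ^ (5 / 3 : ℝ) * c ≤
      ∫ x in {x : EuclideanSpace ℝ (Fin 3) | lam ^ k < ‖x‖ ∧ ‖x‖ < lam ^ (k + 1)}, ‖Q x‖ ^ 2)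
    {p : ℝ} (hp2 : 2 ≤ p) (hp : p ≤ 9 / 2) : ¬ MemLp Q (ENNReal.ofReal p) volume := by
  intro hmem
  have hlam0 : 0 < lam := by linarith
  have hp0 : 0 < p := by linarith
  -- `‖Q‖^p` is integrable
  have hint : Integrable (fun x => ‖Q x‖ ^ p) volume := by
    have h := hmem.integrable_norm_rpow (by simp [hp0]) ENNReal.ofReal_ne_top
    simpa [ENNReal.toReal_ofReal hp0.le] using h
  -- the tails `∫_{λ^k < ‖x‖} ‖Q‖^p` tend to `0`
  set S : ℕ → Set (EuclideanSpace ℝ (Fin 3)) := fun k => {x | lam ^ k < ‖x‖} with hS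
  have hSm : ∀ k, MeasurableSet (S k) := fun k =>
    (isOpen_lt continuous_const continuous_norm).measurableSet
  have hanti : Antitone S := fun k l hkl x hx =>
    lt_of_le_of_lt (pow_le_pow_right₀ hlam.le hkl) hx
  have hInter : (⋂ k, S k) = ∅ := by
    ext x
    simp only [mem_iInter, mem_empty_iff_false, iff_false, not_forall, hS, mem_setOf_eq, not_lt]
    obtain ⟨k, hk⟩ := pow_unbounded_of_one_lt ‖x‖ hlam
    exact ⟨k, hk.le⟩
  have htail : Tendsto (fun k => ∫ x in S k, ‖Q x‖ ^ p) atTop (𝓝 0) := by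
    have h := tendsto_setIntegral_of_antitone hSm hanti ⟨0, hint.integrableOn⟩
    simpa [hInter] using h
  -- hence the shell integrals `ε k = ∫_{shell k} ‖Q‖^p` tend to `0`
  have hε : Tendsto (fun k : ℕ =>
      ∫ x in {x : EuclideanSpace ℝ (Fin 3) | lam ^ k < ‖x‖ ∧ ‖x‖ < lam ^ (k + 1)}, ‖Q x‖ ^ p)
      atTop (𝓝 0) := by
    refine tendsto_of_tendsto_of_tendsto_of_le_of_le tendsto_const_nhds htail (fun k => ?_) fun k => ?_
    · exact integral_nonneg fun x => by positivity
    · exact setIntegral_mono_set hint.integrableOn (ae_of_all _ fun x => by positivity)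
        (ae_of_all _ fun x hx => hx.1)
  -- Hölder on each shell: `∫‖Q‖² ≤ ε_k^{2/p} ((λ^k)³ v₀)^{1-2/p}` (for `p > 2`; trivial for `p = 2`)
  set v₀ : ℝ := volume.real {x : EuclideanSpace ℝ (Fin 3) | 1 < ‖x‖ ∧ ‖x‖ < lam} with hv₀
  have hv₀pos : 0 < v₀ := coneDissip_volumeReal_shell_pos hlam
  have hholder : ∀ k : ℕ,
      ∫ x in {x : EuclideanSpace ℝ (Fin 3) | lam ^ k < ‖x‖ ∧ ‖x‖ < lam ^ (k + 1)}, ‖Q x‖ ^ 2 ≤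
        (∫ x in {x : EuclideanSpace ℝ (Fin 3) | lam ^ k < ‖x‖ ∧ ‖x‖ < lam ^ (k + 1)}, ‖Q x‖ ^ p) ^ (2 / p) *
          ((lam ^ k) ^ 3 * v₀) ^ (1 - 2 / p) := by
    intro k
    have hLk : 0 < lam ^ k := pow_pos hlam0 k
    set A : Set (EuclideanSpace ℝ (Fin 3)) :=
      {x : EuclideanSpace ℝ (Fin 3) | lam ^ k < ‖x‖ ∧ ‖x‖ < lam ^ (k + 1)} with hA
    have hAfin : volume A < ⊤ :=
      (measure_mono fun x hx => mem_ball_zero_iff.2 hx.2).trans_lt measure_ball_lt_top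
    have hAvol : volume.real A = (lam ^ k) ^ 3 * v₀ := volume_real_shell_pow hlam0 k
    haveI : IsFiniteMeasure (volume.restrict A) := isFiniteMeasure_restrict.2 hAfin.ne
    rcases eq_or_lt_of_le hp2 with h2 | h2
    · -- p = 2: the Hölder factor is `1`
      subst h2
      have h1 : (2 : ℝ) / 2 = 1 := by norm_num
      rw [h1, Real.rpow_one, sub_self, Real.rpow_zero, mul_one]
      refine le_of_eq (integral_congr_ae (ae_of_all _ fun x => ?_))
      simp
    · -- p > 2: Hölder with exponents `p/2` and `(p/2)' = p/(p-2)` against the constant `1`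
      have hP : 1 < p / 2 := by linarith
      have hpq := Real.HolderConjugate.conjExponent hP
      -- `Q` is bounded on the shell
      obtain ⟨B, hB⟩ := (isCompact_closedBall (0 : EuclideanSpace ℝ (Fin 3)) (lam ^ (k + 1))).exists_bound_of_continuousOn
        hQ.continuousOn
      have hbound : ∀ᵐ x ∂(volume.restrict A), (fun x => ‖Q x‖ ^ 2) x ∈ Set.Icc 0 (B ^ 2) := by
        filter_upwards [ae_restrict_mem (measurableSet_lt measurable_const measurable_norm |>.inter
          (measurableSet_lt measurable_norm measurable_const))] with x hx
        have hxB : ‖Q x‖ ≤ B := hB x (mem_closedBall_zero_iff.2 hx.2.le)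
        exact ⟨sq_nonneg _, pow_le_pow_left₀ (norm_nonneg _) hxB 2⟩
      have hf : MemLp (fun x => ‖Q x‖ ^ 2) (ENNReal.ofReal (p / 2)) (volume.restrict A) :=
        memLp_of_bounded hbound (hQ.norm.pow 2).aestronglyMeasurable _
      have hg : MemLp (fun _ : EuclideanSpace ℝ (Fin 3) => (1 : ℝ)) (ENNReal.ofReal (p / 2).conjExponent)
          (volume.restrict A) := memLp_const 1
      have h := integral_mul_le_Lp_mul_Lq_of_nonneg hpq (ae_of_all _ fun x => sq_nonneg ‖Q x‖)
        (ae_of_all _ fun _ => zero_le_one) hf hg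
      simp only [mul_one, Real.one_rpow, integral_const, smul_eq_mul] at h
      -- rewrite `(‖Q‖²)^{p/2} = ‖Q‖^p`, `1/(p/2) = 2/p`, `1/(p/2)' = 1 - 2/p`, `|A| = (λ^k)³ v₀`
      have hpow : ∀ x : EuclideanSpace ℝ (Fin 3), (‖Q x‖ ^ 2) ^ (p / 2) = ‖Q x‖ ^ p := fun x => by
        have h2p : ((2 : ℕ) : ℝ) * (p / 2) = p := by push_cast; ring
        rw [← Real.rpow_natCast, ← Real.rpow_mul (norm_nonneg _), h2p]
      have hexp1 : 1 / (p / 2) = 2 / p := by field_simp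
      have hexp2 : 1 / (p / 2).conjExponent = 1 - 2 / p := by
        rw [Real.conjExponent]
        field_simp
      simp_rw [hpow] at h
      rw [hexp1, hexp2, measureReal_restrict_apply_univ, hAvol] at h
      exact h
  -- combine with the floor: `c ≤ ε_k^{2/p} v₀^{1-2/p}` eventually, since `3(1-2/p) ≤ 5/3`
  have hkey : ∀ᶠ k : ℕ in atTop, c ≤
      (∫ x in {x : EuclideanSpace ℝ (Fin 3) | lam ^ k < ‖x‖ ∧ ‖x‖ < lam ^ (k + 1)}, ‖Q x‖ ^ p) ^ (2 / p) *
        v₀ ^ (1 - 2 / p) := by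
    filter_upwards [hfloor] with k hk
    have hLk : 0 < lam ^ k := pow_pos hlam0 k
    have hL1 : 1 ≤ lam ^ k := one_le_pow₀ hlam.le
    have hL53 : 0 < (lam ^ k) ^ (5 / 3 : ℝ) := Real.rpow_pos_of_pos hLk _
    have hεk : 0 ≤ (∫ x in {x : EuclideanSpace ℝ (Fin 3) | lam ^ k < ‖x‖ ∧ ‖x‖ < lam ^ (k + 1)},
        ‖Q x‖ ^ p) ^ (2 / p) := Real.rpow_nonneg (integral_nonneg fun x => by positivity) _
    -- `((λ^k)³ v₀)^{1-2/p} = (λ^k)^{3(1-2/p)} v₀^{1-2/p} ≤ (λ^k)^{5/3} v₀^{1-2/p}`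
    have hsplit : ((lam ^ k) ^ 3 * v₀) ^ (1 - 2 / p) = (lam ^ k) ^ (3 * (1 - 2 / p)) * v₀ ^ (1 - 2 / p) := by
      rw [Real.mul_rpow (pow_nonneg hLk.le 3) hv₀pos.le, ← Real.rpow_natCast (lam ^ k) 3,
        ← Real.rpow_mul hLk.le]
      norm_num
    have hexp : (lam ^ k) ^ (3 * (1 - 2 / p)) ≤ (lam ^ k) ^ (5 / 3 : ℝ) := by
      refine Real.rpow_le_rpow_of_exponent_le hL1 ?_
      have : 2 / p ≥ 2 / (9 / 2) := div_le_div_of_nonneg_left (by norm_num) hp0 hp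
      linarith
    have h1 := hk.trans (hholder k)
    rw [hsplit] at h1
    have h2 : (∫ x in {x : EuclideanSpace ℝ (Fin 3) | lam ^ k < ‖x‖ ∧ ‖x‖ < lam ^ (k + 1)}, ‖Q x‖ ^ p) ^ (2 / p) *
        ((lam ^ k) ^ (3 * (1 - 2 / p)) * v₀ ^ (1 - 2 / p)) ≤
        (∫ x in {x : EuclideanSpace ℝ (Fin 3) | lam ^ k < ‖x‖ ∧ ‖x‖ < lam ^ (k + 1)}, ‖Q x‖ ^ p) ^ (2 / p) *
        ((lam ^ k) ^ (5 / 3 : ℝ) * v₀ ^ (1 - 2 / p)) :=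
      mul_le_mul_of_nonneg_left (mul_le_mul_of_nonneg_right hexp (Real.rpow_nonneg hv₀pos.le _)) hεk
    have h3 := h1.trans h2
    -- divide by `(λ^k)^{5/3} > 0`
    have h4 : (lam ^ k) ^ (5 / 3 : ℝ) * c ≤ (lam ^ k) ^ (5 / 3 : ℝ) *
        ((∫ x in {x : EuclideanSpace ℝ (Fin 3) | lam ^ k < ‖x‖ ∧ ‖x‖ < lam ^ (k + 1)}, ‖Q x‖ ^ p) ^ (2 / p) *
          v₀ ^ (1 - 2 / p)) := by
      calc (lam ^ k) ^ (5 / 3 : ℝ) * c ≤ _ := h3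
        _ = _ := by ring
    exact le_of_mul_le_mul_left h4 hL53
  -- but the right-hand side tends to `0`
  have hlim : Tendsto (fun k : ℕ =>
      (∫ x in {x : EuclideanSpace ℝ (Fin 3) | lam ^ k < ‖x‖ ∧ ‖x‖ < lam ^ (k + 1)}, ‖Q x‖ ^ p) ^ (2 / p) *
        v₀ ^ (1 - 2 / p)) atTop (𝓝 0) := by
    have h1 : Tendsto (fun k : ℕ =>
        (∫ x in {x : EuclideanSpace ℝ (Fin 3) | lam ^ k < ‖x‖ ∧ ‖x‖ < lam ^ (k + 1)}, ‖Q x‖ ^ p) ^ (2 / p))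
        atTop (𝓝 0) := by
      have h := hε.rpow_const (p := 2 / p) (Or.inr (by positivity))
      rwa [Real.zero_rpow (by positivity)] at h
    simpa using h1.mul_const (v₀ ^ (1 - 2 / p))
  have hsmall : ∀ᶠ k : ℕ in atTop,
      (∫ x in {x : EuclideanSpace ℝ (Fin 3) | lam ^ k < ‖x‖ ∧ ‖x‖ < lam ^ (k + 1)}, ‖Q x‖ ^ p) ^ (2 / p) *
        v₀ ^ (1 - 2 / p) < c := (tendsto_order.1 hlim).2 _ hc
  obtain ⟨k, hk1, hk2⟩ := (hkey.and hsmall).exists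
  linarith


/-! ## §4 Targets — line `Sketch` (stubs registered 2026-08-17T11:40Z)

### Stub 5 without the non-triviality of the far field -/

/-- **`0 < ∫_{shell 0}‖V‖²` is load-bearing in `stub_dissipationPosOfFarField`**: with that hypothesis
dropped the stub is false — `V = 0`, `Q = 0`, `λ = 2` satisfy every remaining hypothesis (the matching
clause trivially) while `∫ |∇Q|² = 0`. [folklore] -/
theorem stub_dissipationPosOfFarField_false_without_nontrivial :
    ¬ ∀ (lam : ℝ) (V Q : EuclideanSpace ℝ (Fin 3) → EuclideanSpace ℝ (Fin 3)), 1 < lam →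
      ContDiff ℝ 1 Q → AEStronglyMeasurable V volume →
      (∀ x : EuclideanSpace ℝ (Fin 3), x ≠ 0 → V (lam • x) = lam ^ (-(2 / 3 : ℝ)) • V x) →
      LocallyIntegrableOn (fun x => ‖V x‖ ^ 2) {x : EuclideanSpace ℝ (Fin 3) | x ≠ 0} volume →
      Integrable (fun x => frobeniusNormSq (fderiv ℝ Q x)) →
      Tendsto (fun k : ℕ => (lam ^ k) ^ (-(5 / 3 : ℝ)) *
          ∫ x in {x : EuclideanSpace ℝ (Fin 3) | lam ^ k < ‖x‖ ∧ ‖x‖ < lam ^ (k + 1)}, ‖Q x - V x‖ ^ 2)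
          atTop (𝓝 0) →
      0 < ∫ x, frobeniusNormSq (fderiv ℝ Q x) := by
  intro h
  have := h 2 (fun _ => 0) (fun _ => 0) (by norm_num) contDiff_const aestronglyMeasurable_const
    (fun x _ => by simp) (by simpa using locallyIntegrableOn_zero)
    (by simp [frobeniusNormSq_zero]) (by simp)
  simp [frobeniusNormSq_zero] at this

/-! ## The model cone `V x = ‖x‖^{-2/3} e₀` -/

/-- The model field `x ↦ ‖x‖^{-2/3} e₀` is discretely (indeed continuously) self-similar of degree `-2/3`.
[folklore] -/
theorem model_dss {lam : ℝ} (hlam : 0 < lam) (x : EuclideanSpace ℝ (Fin 3)) :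
    (‖lam • x‖ ^ (-(2 / 3 : ℝ))) • (EuclideanSpace.single 0 (1 : ℝ) : EuclideanSpace ℝ (Fin 3)) =
      lam ^ (-(2 / 3 : ℝ)) •
        ((‖x‖ ^ (-(2 / 3 : ℝ))) • (EuclideanSpace.single 0 (1 : ℝ) : EuclideanSpace ℝ (Fin 3))) := by
  rw [norm_smul, Real.norm_eq_abs, abs_of_pos hlam, Real.mul_rpow hlam.le (norm_nonneg _), smul_smul]

/-- The model field is measurable. [folklore] -/
theorem model_measurable :
    Measurable fun x : EuclideanSpace ℝ (Fin 3) =>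
      (‖x‖ ^ (-(2 / 3 : ℝ))) • (EuclideanSpace.single 0 (1 : ℝ) : EuclideanSpace ℝ (Fin 3)) :=
  (measurable_norm.pow_const _).smul_const _

/-- Squared norm of the model field: `‖V x‖² = (‖x‖^{-2/3})²`. [folklore] -/
theorem norm_model_sq (x : EuclideanSpace ℝ (Fin 3)) :
    ‖(‖x‖ ^ (-(2 / 3 : ℝ))) • (EuclideanSpace.single 0 (1 : ℝ) : EuclideanSpace ℝ (Fin 3))‖ ^ 2 =
      (‖x‖ ^ (-(2 / 3 : ℝ))) ^ 2 := by
  have hn : ‖(EuclideanSpace.single 0 (1 : ℝ) : EuclideanSpace ℝ (Fin 3))‖ = 1 := by simp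
  rw [norm_smul, hn, mul_one, Real.norm_eq_abs, sq_abs]

/-- `‖V‖²` of the model field is locally integrable off the origin (continuous there). [folklore] -/
theorem model_locallyIntegrableOn :
    LocallyIntegrableOn
      (fun x : EuclideanSpace ℝ (Fin 3) =>
        ‖(‖x‖ ^ (-(2 / 3 : ℝ))) • (EuclideanSpace.single 0 (1 : ℝ) : EuclideanSpace ℝ (Fin 3))‖ ^ 2)
      {x : EuclideanSpace ℝ (Fin 3) | x ≠ 0} volume := by
  have h1 : ContinuousOn (fun x : EuclideanSpace ℝ (Fin 3) => ‖x‖ ^ (-(2 / 3 : ℝ)))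
      {x : EuclideanSpace ℝ (Fin 3) | x ≠ 0} :=
    continuous_norm.continuousOn.rpow_const fun x hx => Or.inl (norm_ne_zero_iff.2 hx)
  have h2 : ContinuousOn (fun x : EuclideanSpace ℝ (Fin 3) =>
      (‖x‖ ^ (-(2 / 3 : ℝ))) • (EuclideanSpace.single 0 (1 : ℝ) : EuclideanSpace ℝ (Fin 3)))
      {x : EuclideanSpace ℝ (Fin 3) | x ≠ 0} := h1.smul continuousOn_const
  exact ((h2.norm).pow 2).locallyIntegrableOn isOpen_ne.measurableSet

/-- The model field has positive mass on the fundamental shell `1 < ‖x‖ < 2`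
(`‖V x‖² ≥ (2^{-2/3})²` there, and the shell has positive finite volume). [folklore] -/
theorem model_shell_mass_pos :
    0 < ∫ x in {x : EuclideanSpace ℝ (Fin 3) | 1 < ‖x‖ ∧ ‖x‖ < 2},
      ‖(‖x‖ ^ (-(2 / 3 : ℝ))) • (EuclideanSpace.single 0 (1 : ℝ) : EuclideanSpace ℝ (Fin 3))‖ ^ 2 := by
  have hc : (0 : ℝ) < ((2 : ℝ) ^ (-(2 / 3 : ℝ))) ^ 2 := by positivity
  have hint := coneDissip_integrableOn_shell (lam := 2)
    (V := fun x : EuclideanSpace ℝ (Fin 3) =>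
      (‖x‖ ^ (-(2 / 3 : ℝ))) • (EuclideanSpace.single 0 (1 : ℝ) : EuclideanSpace ℝ (Fin 3)))
    model_locallyIntegrableOn
  have hle : ∫ x in {x : EuclideanSpace ℝ (Fin 3) | 1 < ‖x‖ ∧ ‖x‖ < 2}, ((2 : ℝ) ^ (-(2 / 3 : ℝ))) ^ 2 ≤
      ∫ x in {x : EuclideanSpace ℝ (Fin 3) | 1 < ‖x‖ ∧ ‖x‖ < 2},
        ‖(‖x‖ ^ (-(2 / 3 : ℝ))) • (EuclideanSpace.single 0 (1 : ℝ) : EuclideanSpace ℝ (Fin 3))‖ ^ 2 := by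
    refine setIntegral_mono_on (integrableOn_const (coneDissip_volume_shell_lt_top 2).ne) hint
      (coneDissip_isOpen_shell 2).measurableSet fun x hx => ?_
    rw [norm_model_sq]
    have h1 : (2 : ℝ) ^ (-(2 / 3 : ℝ)) ≤ ‖x‖ ^ (-(2 / 3 : ℝ)) :=
      Real.rpow_le_rpow_of_nonpos (by linarith [hx.1]) hx.2.le (by norm_num)
    exact pow_le_pow_left₀ (Real.rpow_nonneg (by norm_num) _) h1 2
  rw [setIntegral_const, smul_eq_mul] at hle
  have hpos : 0 < volume.real {x : EuclideanSpace ℝ (Fin 3) | 1 < ‖x‖ ∧ ‖x‖ < 2} * ((2 : ℝ) ^ (-(2 / 3 : ℝ))) ^ 2 :=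
    mul_pos (coneDissip_volumeReal_shell_pos (by norm_num)) hc
  linarith

/-! ## Stub 5 without the shell-matching clause -/

/-- **The shell-matching clause is load-bearing in `stub_dissipationPosOfFarField`**: with it dropped
the stub is false — `Q = 0` and the model cone `V x = ‖x‖^{-2/3} e₀` (`λ = 2`) satisfy every remaining
hypothesis, including `0 < ∫_{1<‖x‖<2}‖V‖²`, while `∫ |∇Q|² = 0`. [folklore] -/
theorem stub_dissipationPosOfFarField_false_without_matching :
    ¬ ∀ (lam : ℝ) (V Q : EuclideanSpace ℝ (Fin 3) → EuclideanSpace ℝ (Fin 3)), 1 < lam →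
      ContDiff ℝ 1 Q → AEStronglyMeasurable V volume →
      (∀ x : EuclideanSpace ℝ (Fin 3), x ≠ 0 → V (lam • x) = lam ^ (-(2 / 3 : ℝ)) • V x) →
      LocallyIntegrableOn (fun x => ‖V x‖ ^ 2) {x : EuclideanSpace ℝ (Fin 3) | x ≠ 0} volume →
      0 < ∫ x in {x : EuclideanSpace ℝ (Fin 3) | 1 < ‖x‖ ∧ ‖x‖ < lam}, ‖V x‖ ^ 2 →
      Integrable (fun x => frobeniusNormSq (fderiv ℝ Q x)) →
      0 < ∫ x, frobeniusNormSq (fderiv ℝ Q x) := by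
  intro h
  have := h 2
    (fun x => (‖x‖ ^ (-(2 / 3 : ℝ))) • (EuclideanSpace.single 0 (1 : ℝ) : EuclideanSpace ℝ (Fin 3)))
    (fun _ => 0) (by norm_num) contDiff_const model_measurable.aestronglyMeasurable
    (fun x _ => model_dss (by norm_num) x) model_locallyIntegrableOn model_shell_mass_pos
    (by simp [frobeniusNormSq_zero])
  simp [frobeniusNormSq_zero] at this

/-! ## Stub 4 without the shell-matching clause -/

/-- **The shell-matching clause is load-bearing in `stub_envelopeOfFarField`**: with it dropped the
stub is false — `V = 0` and the constant field `Q ≡ e₀` (`λ = 2`) satisfy every remaining hypothesis, but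
`∫_{B_R} ‖Q‖² = R³ |B_1|` admits no bound `C R^{5/3}` (`R^{5/3} ≤ R²` for `R ≥ 1`, so `|B_1| R ≤ C`
for all `R ≥ 1`, absurd). [folklore] -/
theorem stub_envelopeOfFarField_false_without_matching :
    ¬ ∀ (lam : ℝ) (V Q : EuclideanSpace ℝ (Fin 3) → EuclideanSpace ℝ (Fin 3)), 1 < lam →
      Continuous Q → AEStronglyMeasurable V volume →
      (∀ x : EuclideanSpace ℝ (Fin 3), x ≠ 0 → V (lam • x) = lam ^ (-(2 / 3 : ℝ)) • V x) →
      LocallyIntegrableOn (fun x => ‖V x‖ ^ 2) {x : EuclideanSpace ℝ (Fin 3) | x ≠ 0} volume →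
      ∃ C : ℝ, ∀ R : ℝ, 1 ≤ R →
        ∫ x in Metric.ball (0 : EuclideanSpace ℝ (Fin 3)) R, ‖Q x‖ ^ 2 ≤ C * R ^ (5 / 3 : ℝ) := by
  intro h
  obtain ⟨C, hC⟩ := h 2 (fun _ => 0)
    (fun _ => (EuclideanSpace.single 0 (1 : ℝ) : EuclideanSpace ℝ (Fin 3))) (by norm_num)
    continuous_const aestronglyMeasurable_const (fun x _ => by simp) (by simpa using locallyIntegrableOn_zero)
  -- volumes of balls: `|B_R| = R³ |B_1|`, `|B_1| > 0`
  set v₁ : ℝ := volume.real (Metric.ball (0 : EuclideanSpace ℝ (Fin 3)) 1) with hv₁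
  have hv₁pos : 0 < v₁ :=
    ENNReal.toReal_pos (Metric.measure_ball_pos volume (0 : EuclideanSpace ℝ (Fin 3)) one_pos).ne'
      (measure_ball_lt_top).ne
  have hball : ∀ R : ℝ, 0 < R →
      volume.real (Metric.ball (0 : EuclideanSpace ℝ (Fin 3)) R) = R ^ 3 * v₁ := by
    intro R hR
    simp only [hv₁, measureReal_def]
    rw [Measure.addHaar_ball_of_pos volume (0 : EuclideanSpace ℝ (Fin 3)) hR, ENNReal.toReal_mul,
      ENNReal.toReal_ofReal (pow_nonneg hR.le _), finrank_euclideanSpace_fin]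
  have key : ∀ R : ℝ, 1 ≤ R → R ^ 3 * v₁ ≤ C * R ^ (5 / 3 : ℝ) := by
    intro R hR
    have h1 := hC R hR
    have hn : ‖(EuclideanSpace.single 0 (1 : ℝ) : EuclideanSpace ℝ (Fin 3))‖ = 1 := by simp
    simp only [hn, one_pow] at h1
    rwa [setIntegral_const, smul_eq_mul, mul_one, hball R (by linarith)] at h1
  have key2 : ∀ R : ℝ, 1 ≤ R → v₁ * R ≤ C := by
    intro R hR
    have hR0 : 0 < R := by linarith
    have h53 : R ^ (5 / 3 : ℝ) ≤ R ^ (2 : ℝ) := Real.rpow_le_rpow_of_exponent_le hR (by norm_num)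
    rw [Real.rpow_two] at h53
    have hC0 : 0 ≤ C := by
      have := key 1 le_rfl
      simp at this
      linarith
    have h3 : R ^ 3 * v₁ ≤ C * R ^ 2 := (key R hR).trans (mul_le_mul_of_nonneg_left h53 hC0)
    have hR2 : 0 < R ^ 2 := by positivity
    have : v₁ * R * R ^ 2 ≤ C * R ^ 2 := by nlinarith
    exact le_of_mul_le_mul_right this hR2
  have h1 := key2 (max 1 (C / v₁ + 1)) (le_max_left _ _)
  have h2 : v₁ * (C / v₁ + 1) ≤ C := (mul_le_mul_of_nonneg_left (le_max_right _ _) hv₁pos.le).trans h1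
  rw [mul_add, mul_div_cancel₀ _ hv₁pos.ne', mul_one] at h2
  linarith


/-! ## §4b `stub_core` — the open stub

`stub_core` is the crux with the conclusion tied to THE GIVEN cone (`V`, `λ` of the hypothesis) and the
redundant clauses removed; as a `∀` over cones it is refutable only by exhibiting a point-flux cone for which no
soliton exists — the same double shield (`not_crux_iff`). Its conclusion is trivially inhabited when the far
field vanishes, which is exactly what `flux < 0` (via stub 2) excludes: -/

/-- The conclusion of `stub_core` at the ZERO far field is inhabited by `Q = 0`, `Pr = 0`: all the
difficulty of the stub enters through the non-triviality of the cone forced by `flux < 0`. [folklore] -/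
theorem stub_core_conclusion_at_zero {lam : ℝ} (hlam : 1 < lam) :
    ∃ (Q : EuclideanSpace ℝ (Fin 3) → EuclideanSpace ℝ (Fin 3)) (Pr : EuclideanSpace ℝ (Fin 3) → ℝ),
      IsSteadyClassicalNS 1 0 Q Pr ∧
      Integrable (fun x => frobeniusNormSq (fderiv ℝ Q x)) ∧
      Tendsto (fun k : ℕ => (lam ^ k) ^ (-(5 / 3 : ℝ)) *
        ∫ x in {x : EuclideanSpace ℝ (Fin 3) | lam ^ k < ‖x‖ ∧ ‖x‖ < lam ^ (k + 1)},
          ‖Q x - (0 : EuclideanSpace ℝ (Fin 3) → EuclideanSpace ℝ (Fin 3)) x‖ ^ 2) atTop (𝓝 0) := by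
  have _ := hlam
  refine ⟨fun _ => 0, fun _ => 0, ?_, by simp [frobeniusNormSq_zero], by simp⟩
  exact
    { smooth_velocity := contDiff_const
      smooth_pressure := contDiff_const
      momentum := fun x => by simp [convect, gradient]
      divFree := fun x => by simp [VectorCalculus.divergence] }

/-! ## §5 Cycle 3 (refuter `ad-pointsink-ref-1`, 2026-08-27): FLUX TRANSFER — an `L³ × L^{3/2}`-fed cone is an
inward point-flux cone of strength exactly `D`

Brief of this cycle (director-frontier g9): "Liouville in the `R^{5/3}`-envelope / DSS class via the Galdi gate —
bankable either way". Outcome: NO Liouville theorem bites the class as filed (confirmed again: every printed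
criterion 2022–2026 — Cho–Yang, Vergara-Hermosilla `L^{9/2+ε(·)}`, Chae CMP 2026 `β ≥ 2α`,
Kozono–Terasawa–Wakasugi weak-`L^{9/2}` smallness — is strictly missed by the Kolmogorov class, §2c), and the
reason is now a THEOREM rather than a census: the energy flux through large spheres of a cascade soliton does
not vanish but converges to `−D`, and this flux is INHERITED BY THE CONE whenever the matching is strong enough
for the cubic flux to pass to the limit. Landed, sorry-free, standard axioms, under
`Theorems/ConeDesingularisation/Negative/` (six files, chain-imported: p537054 `FluxPairing`, p538412 `BlowdownShells`,
p540081 `FluxTransfer`, p540736 `RadialCutoff`, p541722 `LogMeanFlux`, p542740 `FedConeFlux`, and the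
profile-constraint addendum p544346 `FedConeFloor`):

* `FluxPairing`     — Hölder `(3, 3/2)` toolkit; `flux_pairing_tendsto`: the cubic flux pairing
  `(u, p) ↦ ∫ (½‖u‖² + p) w[u]` is continuous under `u → V` in `L³(A)`, `p → Π` in `L^{3/2}(A)`.
* `BlowdownShells`  — shell geometry, `cubicDefect_dilate` / `presDefect_dilate` (blow-down bookkeeping of the
  `L³` / `L^{3/2}` defects), double-shell squeeze.
* `FluxTransfer`    — `fedCone_smoothFlux_eq_dissipation`: for `(Q, P)` as in `CascadeSoliton`, matched to a DSS
  pair `(V, Π)` (degrees `−2/3`, `−4/3`; `‖V‖², ‖V‖³, |Π|^{3/2} ∈ L¹_loc(ℝ³∖0)`) in `L²` AND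
  `(λ^k)⁻¹ ∫_{shell k} ‖Q − V‖³ → 0`, `(λ^k)⁻¹ ∫_{shell k} |P − Π|^{3/2} → 0`, every smooth shell cutoff `ψ`
  (`= 1` on `‖x‖ < r`, `r > 1`; `= 0` beyond `b < λ²`) has `∫ (½‖V‖² + Π) Dψ[V] = D` (route's own
  `coreFamily_energyFlux_tendsto` + `stub_solitonCoreFamily` + `flux_pairing_tendsto`).
* `RadialCutoff`, `LogMeanFlux` — `logMeanFlux_eq_of_constantSmoothFlux`: a `c`-independent smooth flux `τ`
  through the dilates `G(‖x‖²/c²)`, `c ∈ [1, λ]`, forces the SHARP law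
  `∫_{1<‖x‖<λ} (½‖V‖² + Π) ⟪V, x⟫/‖x‖² = −τ log λ` (Fubini average in `c`; exact `λ⁻³` covariance).
* `FedConeFlux`     — HEADLINE `fedCone_logMeanFlux_eq`: the fed cone satisfies
  `∫_{1<‖x‖<λ} (½‖V‖² + Π) ⟪V, x⟫/‖x‖² = −D log λ`, i.e. it is a `PointFluxCone` witness with `ε = D` FORCED;
  corollaries `not_cascadeSoliton_L3fedBy_c1EulerCone` (no `C¹` classical Euler cone — Landau-type, smooth DSS
  profile — can be the `L³ × L^{3/2}` far field of a cascade soliton; via `stub_c1ConeFluxless`) and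
  `not_cascadeSoliton_L3fedBy_renormalisedCone` (nor any measurable DSS cone obeying the renormalised local
  energy balance off the origin, e.g. any strong-`L³_loc` weak Euler limit; via `stub_dssFluxRigidity`).
* `FedConeFloor`    — `pointFluxCone_shell_charge`: ANY measurable cone with the point-flux law of strength `ε`
  on the fundamental shell has `(5/6)∫_{1<‖x‖<λ}‖V‖³ + (2/3)∫_{1<‖x‖<λ}|Π|^{3/2} ≥ ε log λ` (Young `(3, 3/2)`) —
  a PROFILE CONSTRAINT for `PointFluxCone` hunters (convex-integration witnesses with `ε > 0` must carry this
  much `L³ × L^{3/2}` mass per shell; complements the `L²` shell-mass floor of §1); `fedCone_shell_charge(_pos)`: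
  the fed far field of a cascade soliton carries `≥ D log λ > 0` per shell.

READING FOR THE CRUX. `CascadeSoliton` as filed asks for `L²` shell matching only; the natural strengthening in
which the cone genuinely CARRIES the cascade (`L³ × L^{3/2}` matching = the Onsager/Duchon–Robert class where
energy flux is defined) is reduced to: the cone is an irregular (non-renormalisable OFF the apex) dissipative
steady Euler solution on `ℝ³∖0` swallowing exactly `D log λ` per fundamental shell. No such steady DSS Euler
field is known (the only `PointFluxCone` witness in the tree, `PointFluxCone_of`, is fluxless); every explicit
cone family of §§0–4 (potential, Beltrami, shear, `C¹` profiles) is excluded as a FED far field outright.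
Conversely, with `L²` matching only, the flux identity is lost in the limit — the far field then carries no
computable trace of `D`, which is exactly why no Liouville theorem in the `R^{5/3}`/DSS class is in reach
(§2c, `LpEscape`): the statement as filed is shielded, its physically meaningful strengthening is pinned to the
0-dimensional stationary Onsager problem WITH PRESCRIBED FLUX `D`.

Hypothesis bookkeeping (for provers/ideators): `hL2` (the crux's clause) is kept beside `hL3` although it
follows from it on bounded shells; the `C¹`-Euler property of `(V, Π)` in the first corollary is a hypothesis
(it follows from `C¹` + `L³ × L^{3/2}` matching by passing to the limit in the weak NS identity, not
formalised); DiPerna–Lions (strong `L³_loc` limits are renormalised) is not formalised — the second corollary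
takes the renormalised balance itself as hypothesis, verbatim from `stub_dssFluxRigidity`.

Not attempted / still dead (one line each): Liouville proper in the Kolmogorov class (flux `= −D ≠ 0` by
design — now a theorem); kinematic obstruction to core pinning (false: mollify at relative scale); head-sign /
suction lemma (needs Calderón–Zygmund `P ∈ L³_loc` + pressure convergence, absent); discharging
`wang2025_rem21` (needs `L^∞` regularity of steady `D`-solutions, absent); momentum-flux balance (null for DSS
degree `≠ −1`).

presearch: flux-transfer / "far-field cone inherits the dissipation as Euler energy flux" → none in print for
the steady blow-down at infinity (nearest: Duchon–Robert 2000 local energy balance; Korolev–Šverák 2011 Landau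
asymptotics at decay `1/|x|`; time-dependent RDSS arXiv:2607.09619); corpus + galaxy, no outage.
-/

/-- Pointer (elaboration check of the landed headline): an `L³ × L^{3/2}`-fed cone has log-mean flux `−D log λ`. -/
example := @Summit.AnomalousDissipation.AnomalousDissipation.Theorems.ConeDesingularisation.Negative.fedCone_logMeanFlux_eq

/-- Pointer: no `C¹` Euler cone feeds a cascade soliton in `L³ × L^{3/2}`. -/
example := @Summit.AnomalousDissipation.AnomalousDissipation.Theorems.ConeDesingularisation.Negative.not_cascadeSoliton_L3fedBy_c1EulerCone

/-- Pointer: no renormalised cone feeds a cascade soliton in `L³ × L^{3/2}`. -/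
example := @Summit.AnomalousDissipation.AnomalousDissipation.Theorems.ConeDesingularisation.Negative.not_cascadeSoliton_L3fedBy_renormalisedCone

/-- Pointer: a point-flux cone of strength `ε` charges the fundamental shell in `L³ × L^{3/2}`. -/
example := @Summit.AnomalousDissipation.AnomalousDissipation.Theorems.ConeDesingularisation.Negative.pointFluxCone_shell_charge


/-! ## HANDOFF (refuter ad-pointsink-ref-1, 2026-08-27)
* Landed under `Theorems/ConeDesingularisation/Negative/`: `FarFieldMass`, `LiouvilleReduction`, `SketchStubs`,
  `LpEscape`, `ConeDesingularisationFalseOfSteadyDSolutionLiouvilleProblem` (negative-modulo-Liouville, p167258), and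
  the flux-transfer chain `FluxPairing` p537054 · `BlowdownShells` p538412 · `FluxTransfer` p540081 · `RadialCutoff`
  p540736 · `LogMeanFlux` p541722 · `FedConeFlux` p542740 · `FedConeFloor` p544346.
* Sorried here: nothing new in §5 (§4b near-misses of earlier cycles unchanged).
* Status of the crux: OPEN, shielded as filed (`L²` matching ⇒ refutation = Liouville in the Kolmogorov class);
  its `L³ × L^{3/2}`-fed strengthening pinned to a point-flux cone of strength `D` (non-`C¹`, non-renormalisable).
* Next regimes for a successor: (i) a head-sign / suction lemma for fed cones (needs Calderón–Zygmund control of `Π`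
  from `V ⊗ V`, i.e. `Π ∈ L^{3/2}_loc` automatically — would remove the pressure-matching hypothesis `hP32`);
  (ii) `L²`-only matching: is there ANY necessary condition on `V` beyond `V ≢ 0` (§1) and the very-weak Euler
  property (NodeClass)? candidates: defect-measure form of the flux law (the cubic defect `(λ^k)⁻¹∫‖Q−V‖³` need not
  vanish but its flux contribution is a non-negative? — sign unknown, this is the real question); (iii) if a
  `PointFluxCone` witness WITH `ε > 0` ever lands (convex integration), test it against `fedCone_logMeanFlux_eq`'s
  regularity exclusions.
-/


end Summit.AnomalousDissipation.AnomalousDissipation.Cruxes.ConeDesingularisation.Disproof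

end
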